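import Mathlib
import HarnessLib
import Literature.AlgebraicGeometry.DeterminantalHypersurfaces.LinearPencilForms
import Summits.ValiantsHypothesis.ValiantsHypothesis.Theorems.PermanentalConesHyperbolicVPShadowStubTernaryPencilHyperbolicForm

/-!
# ValiantsHypothesis / PermanentalCones — `HyperbolicVPShadow`, stub `framePencil`

Route `PermanentalCones`, item `stmt-ValiantsHypothesis-8655` (crux `HyperbolicVPShadow`), line
`birth`, stub `stub_framePencil_hyperbolicForm` (real-spectrum pencils on frames of any size `k`
give `k`-ary hyperbolic forms, in the root-counting rendering of Lewis–Parrilo–Ramana; this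
generalises stub T, `stub_ternaryPencil_hyperbolicForm`, which is the case `k = 3`).

Given real `N × N` matrices `b₀, …, b_{k-1}` with `Σ eᵢ bᵢ = 1` such that every real
combination `Σ wᵢ bᵢ` has only real (complex) eigenvalues, the form
`F := det (Σ Xᵢ bᵢ) ∈ ℝ[X₀, …, X_{k-1}]` is homogeneous of degree `N`, `F(e) = det 1 = 1`,
`F(v) = det (Σ vᵢ bᵢ)`, and for every `w` the univariate polynomial
`t ↦ F(w − t e) = det (Σ wᵢ bᵢ − t·1) = (−1)^N χ_M(t)` (`M := Σ wᵢ bᵢ`) has `N` real roots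
counted with multiplicity, because `χ_M` splits over `ℝ`
(`permanentalCones_charpoly_splits_of_realSpectrum`, from stub T's file).
-/

-- `<Problem> = <Summit>` for this single-conjunct summit (lakefile sets the same option tree-wide).
set_option linter.dupNamespace false

namespace Summit.ValiantsHypothesis.ValiantsHypothesis.Theorems

open Matrix Polynomial

/-- **Stub (real-spectrum frame pencil ⇒ hyperbolic `k`-ary form).** For real `N × N`
matrices `b₀, …, b_{k-1}` with `Σ eᵢ bᵢ = 1` all of whose real combinations have only real
eigenvalues, `F := det (Σ Xᵢ bᵢ)` is a `k`-ary form of degree `N` with `F(e) = 1`,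
`F(v) = det (Σ vᵢ bᵢ)`, and `t ↦ F(w − t e)` has `N` real roots for every `w ∈ ℝᵏ`
(hyperbolicity with respect to `e`). The case `k = 3` is `stub_ternaryPencil_hyperbolicForm`.
[folklore] -/
theorem stub_framePencil_hyperbolicForm :
    ∀ (N k : ℕ) (b : Fin k → Matrix (Fin N) (Fin N) ℝ) (e : Fin k → ℝ),
      ∑ i, e i • b i = 1 →
      (∀ (w : Fin k → ℝ) (z : ℂ),
        ((∑ i, w i • b i).map (algebraMap ℝ ℂ) - z • (1 : Matrix (Fin N) (Fin N) ℂ)).det = 0 →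
          z.im = 0) →
      ∃ F : MvPolynomial (Fin k) ℝ, F.IsHomogeneous N ∧ MvPolynomial.eval e F = 1 ∧
        (∀ w : Fin k → ℝ, Multiset.card (MvPolynomial.aeval
          (fun i => Polynomial.C (w i) - Polynomial.C (e i) * Polynomial.X) F).roots = N) ∧
        ∀ v : Fin k → ℝ, MvPolynomial.eval v F = (∑ i, v i • b i).det := by
  intro N k b e he hreal
  -- the pencil `Σ Xₗ bₗ` with entries in `ℝ[X₀, …, X_{k-1}]`, its determinant is the form `F`
  have hhom :=
    Literature.AlgebraicGeometry.DeterminantalHypersurfaces.isHomogeneous_det_sum_X_smul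
      (R := ℝ) (ι := Fin k) b
  have heval :=
    Literature.AlgebraicGeometry.DeterminantalHypersurfaces.eval_det_sum_X_smul
      (R := ℝ) (ι := Fin k) b
  rw [Fintype.card_fin] at hhom
  set P : Matrix (Fin N) (Fin N) (MvPolynomial (Fin k) ℝ) :=
    ∑ l, (MvPolynomial.X l : MvPolynomial (Fin k) ℝ) • (b l).map MvPolynomial.C with hP
  have hPij : ∀ i j, P i j = ∑ l, MvPolynomial.X l * MvPolynomial.C (b l i j) := by
    intro i j
    simp only [hP, Matrix.sum_apply, Matrix.smul_apply, Matrix.map_apply, smul_eq_mul]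
  refine ⟨P.det, hhom, ?_, ?_, heval⟩
  · -- normalised at `e`: `F(e) = det (Σ eᵢ bᵢ) = det 1 = 1`
    rw [heval, he, det_one]
  · -- hyperbolic w.r.t. `e`: `F(w - te) = (-1)^N det(t·1 - M)`, `M = Σ wᵢ bᵢ`
    intro w
    set g : Fin k → ℝ[X] := fun i => Polynomial.C (w i) - Polynomial.C (e i) * Polynomial.X
      with hg
    set M : Matrix (Fin N) (Fin N) ℝ := ∑ i, w i • b i with hM
    have hmat : (MvPolynomial.aeval g).toRingHom.mapMatrix P = -charmatrix M := by
      refine Matrix.ext fun i j => ?_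
      have hdiag : (Matrix.diagonal fun _ : Fin N => (X : ℝ[X])) i j =
          X * Polynomial.C ((∑ l, e l • b l) i j) := by
        rw [he, Matrix.diagonal_apply, Matrix.one_apply]
        split_ifs <;> simp
      rw [RingHom.mapMatrix_apply, Matrix.map_apply, hPij, Matrix.neg_apply, charmatrix_apply,
        hdiag]
      simp only [hg, hM, Matrix.sum_apply, Matrix.smul_apply, smul_eq_mul, map_mul, map_sum,
        AlgHom.toRingHom_eq_coe, RingHom.coe_coe, MvPolynomial.aeval_X, MvPolynomial.algHom_C,
        Polynomial.algebraMap_eq, Finset.mul_sum, neg_sub]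
      rw [← Finset.sum_sub_distrib]
      refine Finset.sum_congr rfl fun l _ => ?_
      ring
    have hdet : MvPolynomial.aeval g P.det = Polynomial.C ((-1 : ℝ) ^ N) * M.charpoly := by
      rw [show MvPolynomial.aeval g P.det = (MvPolynomial.aeval g).toRingHom P.det from rfl,
        RingHom.map_det, hmat, det_neg, Fintype.card_fin, Matrix.charpoly, map_pow, map_neg,
        map_one]
    change Multiset.card (MvPolynomial.aeval g P.det).roots = N
    rw [hdet, roots_C_mul _ (pow_ne_zero _ (neg_ne_zero.mpr one_ne_zero)),
      splits_iff_card_roots.mp (permanentalCones_charpoly_splits_of_realSpectrum M (hreal w)),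
      charpoly_natDegree_eq_dim, Fintype.card_fin]

end Summit.ValiantsHypothesis.ValiantsHypothesis.Theorems
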